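import Summits.QuantumFields.YangMills.Theses.ThermalDescent
import Literature.MathematicalPhysics.QuantumFieldTheory.WilsonFinTorusSpectralData
import Summits.QuantumFields.YangMills.Theorems.ThermalDescentHsChainSpectral

/-!
# BC3 birth skeleton — crux `HsTransfer` (stmt-QuantumFields-27307, child of `PeriodDescent` 26517) of route `ThermalDescent` (rev 5)

Ideator ym-idea-6 g5, 2026-08-28.  Two registered stubs and the kernel-checked composition
`HsTransfer_of : ThermalDescent.HsTransfer` (uses exactly `stub_slabChain`, `stub_chainSpectral`; sorries ONLY inside `stub_*`).
Currency = the items' verbatim `let`-chain (cubic spatial torus `S³`, period `T`, time = last `Fin` coordinate, `E`/`Cov`/`refl`/`B` as in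
the route file); slices = spatial link configurations `FinSpatialSite S S S × Fin 3 → G` with the product Haar measure, `K = finTorusSliceKernel r.ρ β`
the Osterwalder–Seiler slice kernel of the tree (`WilsonFinTorusSliceKernel`).

* `stub_slabChain` (L−, path-space bookkeeping): for `v` in the window (`tsupport v ⊆ {δ₁ < y₀ < δ₂}`, `2δ₂ + 2s ≤ sT`) there are `m ≤ T`
  (namely `m = 2τ + 3`, `τ` = the last lattice time carrying `v`), a bounded strongly measurable SLAB KERNEL `Xk(u,u')` (the slab `[1, τ+1]` of the
  centred observable `F = B_v − E_T B_v`, temporal links and interior slices integrated out — `integral_cyclic_block_contract`,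
  `finTorusWeight_assemble`, `integral_pi_eq_integral_finTorusAssemble`) such that for EVERY period `m + a₀` the unnormalised two-point function
  `Z·E_{m+a₀}[F∘refl · F]` is the cyclic chain integral with the two bond insertions `Xk` (site `0 → 1`) and its TRANSPOSE (the reflected slab:
  `refl` reverses the slab and inverts temporal links — `finTorusTemporalAction_swap_inv`, Haar inversion invariance) separated by `a₀ + 1` copies
  of `K` and followed by `2` copies of `K` (through the slice `t = 0`) — literally the left-hand side of `integral_cyclic_insert_two` with
  `a := a₀ + 1`, `b' := 1`.  `Xk` does not depend on the period: the window pins the slab.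
* `stub_chainSpectral` (M, operator theory over the tree): for `β ≥ 0` and ANY bounded strongly measurable bond kernel `Xk`, that cyclic
  integral is the double spectral sum `Σ_{(i,j)} λⱼ^(a₀+1) λᵢ² M_{ij}²` over an eigenbasis of the (compact, self-adjoint, Lüscher-positive) transfer
  operator, `0 ≤ λᵢ ≤ λ_{i₀} = transferSpectralRadius r.ρ β S`, with `M_{ij} = ⟪bᵢ, 𝒳 bⱼ⟫` INDEPENDENT of `a₀` — `integral_cyclic_insert_two` +
  `hasSum_integral_iterate_insert_two_succ` (`a := a₀`, `b' := 0`) + `⟪bⱼ, 𝒳ᵀ bᵢ⟫ = ⟪bᵢ, 𝒳 bⱼ⟫` (kernel transpose = `L²` adjoint) + the cubic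
  `exists_spectralData_wilsonFinTorusPartition` identification of `λ_{i₀}`.

Composition: write `T = m + a₀`, `T' = m + (a₀ + d)`; both sides of `HsTransfer` are values of the same non-negative double series with
`λⱼ^(a₀+d+1) ≤ λ_{i₀}^d · λⱼ^(a₀+1)` termwise (`hasSum_le`).  Per-stub probes: neither stub is the crux (an identity, resp. a spectral
representation valid for every kernel) nor NT.  No summit, leg or spine crux is proved here; NT stays open.
-/

set_option autoImplicit false
set_option maxHeartbeats 800000
set_option linter.unusedVariables false

namespace Summit.QuantumFields.YangMills.Cruxes.HsTransfer.Birth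

open MeasureTheory Function Literature.MathematicalPhysics.QuantumFieldTheory Literature.MathematicalPhysics.QuantumLattice

/-- STUB (L−, OPEN) `stub_slabChain` — slab contraction to a bounded bond kernel.  Stated with short names (under this file's
`open MeasureTheory Function Literature.MathematicalPhysics.QuantumFieldTheory Literature.MathematicalPhysics.QuantumLattice`),
instance-generic `[MeasurableSpace G] [BorelSpace G]`, and only the value-lets it uses (the stub registry caps a signature at 3900
characters); a prover's Theorems header repeats the registered signature verbatim under the same `open`s. -/
theorem stub_slabChain : ∀ (G : Type) [Group G] [TopologicalSpace G] [IsTopologicalGroup G] [CompactSpace G] [MeasurableSpace G] [BorelSpace G], IsCompactSimpleLieGroup G → ∀ (r : LatticeRep G), let cc : (n : ℕ) → Fin n → ℤ := fun n i => if 2 * i.val < n then (i.val : ℤ) else (i.val : ℤ) - n; let posE : (S T : ℕ) → FinTorusSite S S S T → EuclideanSpace ℝ (Fin 4) := fun S T x => siteToE ![cc T x.2.2.2, cc S x.1, cc S x.2.1, cc S x.2.2.1]; let P : (S T : ℕ) → FinTorusSite S S S T → Fin 4 → Fin 4 → (FinTorusSite S S S T × Fin 4 → G) → ℝ := fun _ _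 x i j U => (r.ρ (finTorusPlaquette U x i j)).trace.re; let A : (S T : ℕ) → FinTorusSite S S S T → (FinTorusSite S S S T × Fin 4 → G) → ℝ := fun S T x U => ∑ q : {q : Fin 4 × Fin 4 // q.1 < q.2}, P S T x q.1.1 q.1.2 U; let w : ℝ → (S T : ℕ) → (FinTorusSite S S S T × Fin 4 → G) → ℝ := fun β S T U => Real.exp (-β * ∑ x : FinTorusSite S S S T, ∑ q : {q : Fin 4 × Fin 4 // q.1 < q.2}, ((r.N : ℝ) - P S T x q.1.1 q.1.2 U)); let E : ℝ → (S T : ℕ) → ((FinTorusSite S S S T × Fin 4 → G) → ℝ) → ℝ := fun β S T F => (∫ U : FinTorusSite S S S T × Fin 4 → G, F U * w β S T U ∂Measure.pi (fun _ => haarProbability G)) / wilsonFinTorusPartition r.ρ β S S S T; let refl : (S T : ℕ) → (FinTorusSite S S S T × Fin 4 → G) → (FinTorusSite S S S T × Fin 4 → G) := fun _ T U e => if e.2 = Fin.last 3 then (U ((e.1.1, e.1.2.1, e.1.2.2.1, Fin.rev e.1.2.2.2), Fin.last 3))⁻¹ else U ((e.1.1, e.1.2.1, e.1.2.2.1, ⟨(T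 - e.1.2.2.2.val) % T, Nat.mod_lt _ e.1.2.2.2.pos⟩), e.2); let B : (S T : ℕ) → ℝ → SchwartzMap (EuclideanSpace ℝ (Fin 4)) ℝ → (FinTorusSite S S S T × Fin 4 → G) → ℝ := fun S T s f U => ∑ x : FinTorusSite S S S T, f (s • posE S T x) * A S T x U; ∀ (β : ℝ) (S : ℕ) [NeZero S] (T : ℕ) (s : ℝ) (v : SchwartzMap (EuclideanSpace ℝ (Fin 4)) ℝ) (δ₁ δ₂ : ℝ), 0 ≤ β → 2 ≤ T → 0 < s → 0 < δ₁ → tsupport v ⊆ {y : EuclideanSpace ℝ (Fin 4) | δ₁ < y 0 ∧ y 0 < δ₂} → 2 * δ₂ + 2 * s ≤ s * T → ∃ (m : ℕ) (Xk : (FinSpatialSite S S S × Fin 3 → G) → (FinSpatialSite S S S × Fin 3 → G) → ℝ) (CX : ℝ), StronglyMeasurable (uncurry Xk) ∧ (∀ x y, ‖Xk x y‖ ≤ CX) ∧ m ≤ T ∧ ∀ a₀ : ℕ, wilsonFinTorusPartition r.ρ β S S S (m + a₀) * E β S (m + a₀) (fun U => (B S (m + a₀) s v (refl S (m + a₀)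 U) - E β S T (B S T s v)) * (B S (m + a₀) s v U - E β S T (B S T s v))) = ∫ V : Fin (1 + ((a₀ + 1) + (1 + 1)) + 1) → (FinSpatialSite S S S × Fin 3 → G), ∏ t : Fin (1 + ((a₀ + 1) + (1 + 1)) + 1), (fun n : ℕ => if n = 0 then Xk else if n = a₀ + 1 + 1 then (fun x y => Xk y x) else finTorusSliceKernel r.ρ β) (t : ℕ) (V t) (V (t + 1)) ∂Measure.pi (fun _ => Measure.pi (fun _ : FinSpatialSite S S S × Fin 3 => haarProbability G)) := by
  sorry

/-- STUB (M, PROVED) `stub_chainSpectral` — two-insertion chain = non-negative double spectral sum, top eigenvalue =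
`transferSpectralRadius`: `Theorems/ThermalDescentHsChainSpectral.lean` (p624777, commit 077ecd1e7081). -/
theorem stub_chainSpectral : ∀ (G : Type) [Group G] [TopologicalSpace G] [IsTopologicalGroup G] [CompactSpace G] [MeasurableSpace G] [BorelSpace G], IsCompactSimpleLieGroup G → ∀ (r : LatticeRep G) (β : ℝ) (S : ℕ) [NeZero S], 0 ≤ β → ∀ (Xk : (FinSpatialSite S S S × Fin 3 → G) → (FinSpatialSite S S S × Fin 3 → G) → ℝ) (CX : ℝ), StronglyMeasurable (uncurry Xk) → (∀ x y, ‖Xk x y‖ ≤ CX) → ∃ (ι : Type) (lam : ι → ℝ) (i₀ : ι) (M : ι × ι → ℝ), (∀ i, 0 ≤ lam i ∧ lam i ≤ lam i₀) ∧ transferSpectralRadius r.ρ β S = lam i₀ ∧ ∀ a₀ : ℕ, HasSum (fun p : ι × ι => lam p.2 ^ (a₀ + 1) * lam p.1 ^ 2 * M p ^ 2) (∫ V : Fin (1 + ((a₀ + 1) + (1 + 1)) + 1) → (FinSpatialSite S S S × Fin 3 → G), ∏ t : Fin (1 + ((a₀ + 1) + (1 + 1)) + 1), (fun n : ℕ =>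 if n = 0 then Xk else if n = a₀ + 1 + 1 then (fun x y => Xk y x) else finTorusSliceKernel r.ρ β) (t : ℕ) (V t) (V (t + 1)) ∂Measure.pi (fun _ => Measure.pi (fun _ : FinSpatialSite S S S × Fin 3 => haarProbability G))) :=
  Summit.QuantumFields.YangMills.Theorems.ThermalDescentHsTransfer.stub_chainSpectral

theorem HsTransfer_of :
    Summit.QuantumFields.YangMills.Theses.ThermalDescent.HsTransfer := by
  intro G _ _ _ _ hG r
  dsimp only
  intro β S _ T T' s v δ₁ δ₂ hβ hT hTT' hs hδ₁ hsupp hsz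
  letI : MeasurableSpace G := borel G
  haveI : BorelSpace G := ⟨rfl⟩
  have h1 := stub_slabChain G hG r
  dsimp only at h1
  obtain ⟨m, Xk, CX, hXm, hXb, hmT, hS1⟩ := h1 β S T s v δ₁ δ₂ hβ hT hs hδ₁ hsupp hsz
  have h2 := stub_chainSpectral G hG r β S hβ Xk CX hXm hXb
  obtain ⟨ι, lam, i₀, M, hlam, hrad, hS2⟩ := h2
  obtain ⟨a₁, hT'⟩ := Nat.exists_eq_add_of_le (le_trans hmT hTT')
  obtain ⟨a₀, hT0⟩ := Nat.exists_eq_add_of_le hmT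
  subst hT'
  subst hT0
  obtain ⟨d, rfl⟩ := Nat.exists_eq_add_of_le (show a₀ ≤ a₁ by omega)
  have e0 := hS1 a₀
  have e1 := hS1 (a₀ + d)
  rw [show m + (a₀ + d) - (m + a₀) = d by omega, e1,
    mul_assoc (Literature.MathematicalPhysics.QuantumFieldTheory.transferSpectralRadius r.ρ β S ^ d) (Literature.MathematicalPhysics.QuantumFieldTheory.wilsonFinTorusPartition r.ρ β S S S (m + a₀)), e0]
  refine hasSum_le (fun p => ?_) (hS2 (a₀ + d)) ((hS2 a₀).mul_left (Literature.MathematicalPhysics.QuantumFieldTheory.transferSpectralRadius r.ρ β S ^ d))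
  rw [hrad]
  have hx : 0 ≤ lam p.2 ^ (a₀ + 1) * lam p.1 ^ 2 * M p ^ 2 := by
    have := (hlam p.2).1; have := (hlam p.1).1; positivity
  have hd : lam p.2 ^ d ≤ lam i₀ ^ d := pow_le_pow_left₀ (hlam p.2).1 (hlam p.2).2 d
  calc lam p.2 ^ (a₀ + d + 1) * lam p.1 ^ 2 * M p ^ 2
      = lam p.2 ^ d * (lam p.2 ^ (a₀ + 1) * lam p.1 ^ 2 * M p ^ 2) := by ring
    _ ≤ lam i₀ ^ d * (lam p.2 ^ (a₀ + 1) * lam p.1 ^ 2 * M p ^ 2) := mul_le_mul_of_nonneg_right hd hx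

end Summit.QuantumFields.YangMills.Cruxes.HsTransfer.Birth
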